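import Summits.NavierStokesRegularity.NavierStokesRegularity.Theses.TypeIQuarterGate
import Summits.NavierStokesRegularity.NavierStokesRegularity.Theorems.TypeIQuarterGateQuarterLawTypeIUniformLocalTypeI
import HarnessLib

/-!
# Shelf 1574, line `sparse_sieve`: stub S1 `UniformLocalTypeI` holds on the Type-I stratum — it follows
# from the residual `NoTypeII` (stmt-0056) by `CountQuarterLaw.uniformLocalTypeI_of_isTypeIBlowup`

Helper file (`--supports stmt-NavierStokesRegularity-1574`). The registered stub
`stub_uniformLocalTypeI` of `Cruxes/EnstrophyQuarterLaw/Lines/sparse_sieve.lean` (signature: every maximal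
classical Leray–Hopf rapidly-decaying-datum solution is `UniformLocalTypeI T u`) is implied by the route
residual `NoTypeII` (`TypeIQuarterGate.NoTypeII` = stmt-0056 verbatim): `NoTypeII` makes every such solution
Type I, and the sup-norm Type-I rate forces uniform local Type I (Seregin 2014 Prop. 3.11 (i), un-zoomed;
tree `CountQuarterLaw.uniformLocalTypeI_of_isTypeIBlowup`). So inside the residual frame of the 1574 shelf
(`EnstrophyQuarterLaw ⇐ 0056 ∧ S1 ∧ S2`, line card `sparse_sieve`) the stub S1 costs NOTHING beyond 0056.

HONEST FRAMING: an implication between OPEN statements (0056 is the shared hard core); `UniformLocalTypeI`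
without Type I, `EnstrophyQuarterLaw` and NS regularity remain OPEN. [cite: Seregin2014, Ch. 6 §6.3 Prop. 3.11 (i)]
-/

-- the problem directory repeats the summit name (`NavierStokesRegularity/NavierStokesRegularity`)
set_option linter.dupNamespace false

noncomputable section

namespace Summit.NavierStokesRegularity.NavierStokesRegularity.Theorems.CountQuarterLaw

open Set MeasureTheory Metric
open Literature.Analysis.FluidPDE

/-- **`NoTypeII ⇒ stub_uniformLocalTypeI`** (the signature of the sparse_sieve stub S1, with the
Cruxes-local predicate `UniformLocalTypeI T u` unfolded verbatim): under the route residual `NoTypeII`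
(stmt-0056) every maximal classical Leray–Hopf solution from a rapidly decaying datum is uniformly locally
Type I. An implication between open statements. [cite: Seregin2014, Ch. 6 §6.3 Prop. 3.11 (i)] -/
theorem uniformLocalTypeI_of_noTypeII
    (hII : Summit.NavierStokesRegularity.NavierStokesRegularity.Theses.TypeIQuarterGate.NoTypeII) :
    ∀ (ν T : ℝ), 0 < ν → 0 < T →
      ∀ (u : ℝ → EuclideanSpace ℝ (Fin 3) → EuclideanSpace ℝ (Fin 3))
        (p : ℝ → EuclideanSpace ℝ (Fin 3) → ℝ),
        IsMaximalSmoothSolution ν 0 u p T → IsLerayHopfOn T ν 0 (u 0) u →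
        HasRapidSpatialDecay (u 0) →
        ∃ M r₀ : ℝ, 0 < M ∧ 0 < r₀ ∧
          (∀ s ∈ Set.Ico 0 T, ∀ (x : EuclideanSpace ℝ (Fin 3)), ∀ R ∈ Set.Ioc 0 r₀,
            ∫⁻ y in Metric.ball x R, ‖u s y‖ₑ ^ 2 ≤ ENNReal.ofReal (M * R)) ∧
          (∀ b ∈ Set.Ioc 0 T, ∀ (x : EuclideanSpace ℝ (Fin 3)), ∀ R ∈ Set.Ioc 0 r₀, R ^ 2 ≤ b →
            ∫⁻ t in Set.Ioo (b - R ^ 2) b, ∫⁻ y in Metric.ball x R, ‖fderiv ℝ (u t) y‖ₑ ^ 2 ≤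
              ENNReal.ofReal (M * R)) := by
  intro ν T hν hT u p hmax hLH hdec
  exact uniformLocalTypeI_of_isTypeIBlowup hν hT hmax.1 hLH hdec (hII ν T hν hT u p hmax hLH hdec)

end Summit.NavierStokesRegularity.NavierStokesRegularity.Theorems.CountQuarterLaw

end
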